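import Mathlib.RepresentationTheory.Homological.GroupCohomology.Functoriality
import HarnessLib

/-!
# Central elements act trivially on group cohomology

For a commutative ring `k`, a group `G`, a `k`-linear representation `A` of `G` and a CENTRAL
element `z ∈ Z(G)`, the `G`-equivariant endomorphism `a ↦ ρ_A(z) a` of `A` induces the IDENTITY on
every `Hⁿ(G, A)` (Mathlib `groupCohomology`, functoriality `groupCohomology.map`).  This is the
special case `c_z = id` of the classical fact that inner automorphisms act trivially on group
cohomology (Serre, *Local Fields*, Ch. VII §5, Prop. 3; Brown, *Cohomology of Groups*, III (8.3)).

Proof (the standard one, through the bar resolution).  Multiplication by `z` is a natural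
endomorphism `θ` of the identity functor of `Rep k G` (`centralEnd`, `centralEnd_comp`) which is
the identity on trivial representations.  On the bar resolution `P → k` it gives a chain map
`Θ : P → P` over `𝟙 k`, hence homotopic to `𝟙 P` (`ProjectiveResolution.liftHomotopy`), so
precomposition with `Θ` is homotopic to the identity on `Hom(P, A)` and induces the identity on its
cohomology; by naturality of `θ`, precomposition with `Θ` is postcomposition with `θ_A`, which
under Mathlib's isomorphism `inhomogeneousCochains A ≅ Hom(P, A)` is the cochain map
`cochainsMap id θ_A` inducing `groupCohomology.map id θ_A`.

Mathlib only.

## References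

* J.-P. Serre, *Local Fields*, GTM 67 (1979), Ch. VII §5, Prop. 3 (inner automorphisms act
  trivially on `H^q(G, A)`). [SerreLocalFields1979]
-/

open CategoryTheory CategoryTheory.Limits groupCohomology Opposite

namespace Literature.Algebra.Homology

universe u

variable {k G : Type u} [CommRing k] [Group G]

/-! ### The natural endomorphism given by a central element -/

/-- The action of a central element `z ∈ Z(G)` on a representation `X`, as an endomorphism of `X`
in `Rep k G` (it is `G`-equivariant because `z` is central). [folklore] -/
noncomputable def centralEnd (X : Rep k G) {z : G} (hz : z ∈ Subgroup.center G) : X ⟶ X :=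
  Rep.ofHom (LinearMap.intertwiningMap_of_isIntertwiningMap X.ρ X.ρ (X.ρ z) fun g v => by
    rw [← Module.End.mul_apply, ← map_mul, ← Module.End.mul_apply, ← map_mul,
      Subgroup.mem_center_iff.1 hz g])

/-- Unfolding `centralEnd` on elements. [folklore] -/
@[simp]
theorem centralEnd_hom_apply (X : Rep k G) {z : G} (hz : z ∈ Subgroup.center G) (x : X) :
    (centralEnd X hz).hom x = X.ρ z x := rfl

/-- `centralEnd` is a natural endomorphism of the identity functor: it commutes with every
morphism of representations. [folklore] -/
theorem centralEnd_comp {X Y : Rep k G} {z : G} (hz : z ∈ Subgroup.center G) (f : X ⟶ Y) :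
    centralEnd X hz ≫ f = f ≫ centralEnd Y hz := by
  refine Rep.hom_ext (Representation.IntertwiningMap.ext (LinearMap.ext fun x => ?_))
  change (f.hom) ((centralEnd X hz).hom x) = (centralEnd Y hz).hom (f.hom x)
  rw [centralEnd_hom_apply, centralEnd_hom_apply, Rep.hom_comm_apply]

/-- On a trivial representation a central element acts as the identity. [folklore] -/
theorem centralEnd_trivial {z : G} (hz : z ∈ Subgroup.center G) (V : Type u) [AddCommGroup V]
    [Module k V] : centralEnd (Rep.trivial k G V) hz = 𝟙 _ := by
  refine Rep.hom_ext (Representation.IntertwiningMap.ext (LinearMap.ext fun x => ?_))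
  change (centralEnd (Rep.trivial k G V) hz).hom x = x
  rw [centralEnd_hom_apply]
  rfl

/-! ### The chain endomorphism of a complex of representations and its homotopy to the identity -/

/-- The chain endomorphism of a complex of representations given by a central element. [folklore] -/
noncomputable def centralChainEnd {ι : Type*} {c : ComplexShape ι} (P : HomologicalComplex (Rep k G) c)
    {z : G} (hz : z ∈ Subgroup.center G) : P ⟶ P where
  f i := centralEnd (P.X i) hz
  comm' i j _ := centralEnd_comp hz (P.d i j)

/-- For a projective resolution `P → X` in `Rep k G`, the chain endomorphism of a central element
lies over the endomorphism of `X`; for `X` trivial it lies over `𝟙 X`, hence is homotopic to the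
identity. [folklore] -/
noncomputable def centralChainEndHomotopy (V : Type u) [AddCommGroup V] [Module k V]
    (P : ProjectiveResolution (Rep.trivial k G V)) {z : G} (hz : z ∈ Subgroup.center G) :
    Homotopy (centralChainEnd P.complex hz) (𝟙 P.complex) := by
  refine ProjectiveResolution.liftHomotopy (𝟙 _) _ _ ?_ (by simp)
  rw [CategoryTheory.Functor.map_id, Category.comp_id]
  refine HomologicalComplex.to_single_hom_ext ?_
  rw [HomologicalComplex.comp_f]
  change centralEnd _ hz ≫ P.π.f 0 = P.π.f 0
  rw [centralEnd_comp hz (P.π.f 0)]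
  -- the target `((single₀).obj (trivial V)).X 0` is the trivial representation
  rw [← cancel_mono (HomologicalComplex.singleObjXSelf (ComplexShape.down ℕ) 0
    (Rep.trivial k G V)).hom, Category.assoc, centralEnd_comp hz, centralEnd_trivial hz V,
    Category.comp_id]

/-! ### Precomposition with the central chain map on `Hom(P, A)` -/

/-- Precomposition with the central chain endomorphism of a projective resolution `P` of a trivial
representation, as a cochain endomorphism of `Hom(P, A)` (`ChainComplex.linearYonedaObj`). [folklore] -/
noncomputable def centralYonedaMap (P : ChainComplex (Rep k G) ℕ) (A : Rep k G) {z : G}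
    (hz : z ∈ Subgroup.center G) : P.linearYonedaObj k A ⟶ P.linearYonedaObj k A :=
  (HomologicalComplex.unopFunctor (ModuleCat k) (ComplexShape.down ℕ)).map
    ((((linearYoneda k (Rep k G)).obj A).rightOp.mapHomologicalComplex (ComplexShape.down ℕ)).map
      (centralChainEnd P hz)).op

/-- Precomposition with the central chain endomorphism induces the IDENTITY on the cohomology of
`Hom(P, A)` (it is homotopic to the identity, `centralChainEndHomotopy`). [folklore] -/
theorem homologyMap_centralYonedaMap {V : Type u} [AddCommGroup V] [Module k V]
    (P : ProjectiveResolution (Rep.trivial k G V)) (A : Rep k G) {z : G} (hz : z ∈ Subgroup.center G)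
    (n : ℕ) : HomologicalComplex.homologyMap (centralYonedaMap P.complex A hz) n = 𝟙 _ := by
  have h := ((((linearYoneda k (Rep k G)).obj A).rightOp.mapHomotopy
    (centralChainEndHomotopy V P hz)).unop).homologyMap_eq n
  rw [CategoryTheory.Functor.map_id, op_id, CategoryTheory.Functor.map_id,
    HomologicalComplex.homologyMap_id] at h
  exact h

/-- Unfolding `centralYonedaMap` on an element `f : P_i ⟶ A` of `Hom(P, A)`: it is `Θ_i ≫ f`. [folklore] -/
theorem centralYonedaMap_f_apply (P : ChainComplex (Rep k G) ℕ) (A : Rep k G) {z : G}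
    (hz : z ∈ Subgroup.center G) (i : ℕ) (f : P.X i ⟶ A) :
    ((centralYonedaMap P A hz).f i).hom f = centralEnd (P.X i) hz ≫ f := by
  rfl

/-! ### Transport to inhomogeneous cochains -/

/-- Under Mathlib's isomorphism `inhomogeneousCochains A ≅ Hom(P, A)` (`P` the bar resolution),
the cochain map of the central endomorphism `θ_A` is precomposition with the central chain map of
`P` (naturality of `θ`). [folklore] -/
theorem cochainsMap_centralEnd_comp_inhomogeneousCochainsIso_hom (A : Rep k G) {z : G}
    (hz : z ∈ Subgroup.center G) :
    cochainsMap (MonoidHom.id G) (centralEnd A hz) ≫ (inhomogeneousCochainsIso A).hom =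
      (inhomogeneousCochainsIso A).hom ≫ centralYonedaMap (Rep.barComplex k G) A hz := by
  refine HomologicalComplex.hom_ext _ _ fun i => ?_
  rw [HomologicalComplex.comp_f, HomologicalComplex.comp_f]
  refine ModuleCat.hom_ext (LinearMap.ext fun x => ?_)
  have hI : (inhomogeneousCochainsIso A).hom.f i =
      (Rep.freeLiftLEquiv k G (Fin i → G) A).toModuleIso.symm.hom := by
    simp only [groupCohomology.inhomogeneousCochainsIso, HomologicalComplex.Hom.isoOfComponents_hom_f]
  set e := Rep.freeLiftLEquiv k G (Fin i → G) A with he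
  have happly : ∀ (f : Rep.free k G (Fin i → G) ⟶ A) (a : Fin i → G),
      f.hom (Finsupp.single a (MonoidAlgebra.single 1 1)) = e f a := fun f a => rfl
  simp only [ModuleCat.hom_comp, LinearMap.comp_apply]
  rw [hI, centralYonedaMap_f_apply]
  refine Rep.free_ext _ _ _ _ _ fun a => ?_
  rw [happly, Rep.hom_comp, Representation.IntertwiningMap.comp_apply, centralEnd_hom_apply,
    Rep.hom_comm_apply, happly]
  have hcm : (ModuleCat.Hom.hom ((cochainsMap (MonoidHom.id G) (centralEnd A hz)).f i)) x =
      fun a => A.ρ z (x a) := by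
    rw [cochainsMap_id_f_hom_eq_compLeft]; rfl
  rw [hcm]
  change e (e.symm _) a = A.ρ z (e (e.symm x) a)
  rw [e.apply_symm_apply, e.apply_symm_apply]

/-! ### The theorem -/

/-- **A central element acts trivially on group cohomology**: for `z ∈ Z(G)` the endomorphism
`a ↦ ρ_A(z) a` of `A` induces the identity of `Hⁿ(G, A)` for every `n` (the pair
`(t ↦ z t z⁻¹, a ↦ z⁻¹ a)` induces the identity and conjugation by a central `z` is trivial).
[cite: SerreLocalFields1979, Ch. VII §5, Prop. 3] -/
theorem map_centralEnd (A : Rep k G) {z : G} (hz : z ∈ Subgroup.center G) (n : ℕ) :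
    groupCohomology.map (MonoidHom.id G) (centralEnd A hz) n = 𝟙 _ := by
  have hΨ : HomologicalComplex.homologyMap (centralYonedaMap (Rep.barComplex k G) A hz) n = 𝟙 _ :=
    homologyMap_centralYonedaMap (Rep.barResolution k G) A hz n
  have hc : cochainsMap (MonoidHom.id G) (centralEnd A hz) =
      (inhomogeneousCochainsIso A).hom ≫ centralYonedaMap (Rep.barComplex k G) A hz ≫
        (inhomogeneousCochainsIso A).inv := by
    rw [← Category.assoc, ← cochainsMap_centralEnd_comp_inhomogeneousCochainsIso_hom, Category.assoc,
      Iso.hom_inv_id, Category.comp_id]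
  change HomologicalComplex.homologyMap (cochainsMap (MonoidHom.id G) (centralEnd A hz)) n = _
  rw [hc, HomologicalComplex.homologyMap_comp, HomologicalComplex.homologyMap_comp, hΨ,
    Category.id_comp, ← HomologicalComplex.homologyMap_comp, Iso.hom_inv_id,
    HomologicalComplex.homologyMap_id]
  rfl

/-- **A central element acts trivially on group cohomology** (form with an arbitrary morphism):
if `φ : A ⟶ A` is the action of a central `z` (`φ a = ρ_A(z) a`), then `Hⁿ(id, φ) = 𝟙` on `Hⁿ(G, A)`.
[cite: SerreLocalFields1979, Ch. VII §5, Prop. 3] -/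
theorem map_eq_id_of_central (A : Rep k G) {z : G} (hz : z ∈ Subgroup.center G) (φ : A ⟶ A)
    (hφ : ∀ a : A, φ.hom a = A.ρ z a) (n : ℕ) :
    groupCohomology.map (MonoidHom.id G) φ n = 𝟙 _ := by
  have h : φ = centralEnd A hz :=
    Rep.hom_ext (Representation.IntertwiningMap.ext (LinearMap.ext fun a => hφ a))
  rw [h]
  exact map_centralEnd A hz n

/-- Element form of `map_eq_id_of_central`: `Hⁿ(id, φ) x = x`. [folklore] -/
theorem map_apply_eq_self_of_central (A : Rep k G) {z : G} (hz : z ∈ Subgroup.center G) (φ : A ⟶ A)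
    (hφ : ∀ a : A, φ.hom a = A.ρ z a) (n : ℕ) (x : groupCohomology A n) :
    (groupCohomology.map (MonoidHom.id G) φ n).hom x = x := by
  rw [map_eq_id_of_central A hz φ hφ n]
  rfl

end Literature.Algebra.Homology
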